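import Summits.QuantumAdvantage.QuantumAdvantage.Theses.CubicForrelation
import Literature.Computability.QuantumComplexity.ForrelationDerivativeTables
import Summits.QuantumAdvantage.QuantumAdvantage.Theorems.CubicForrelationSignedCubicForrelationNotPrBPPStubDualDistance
import Summits.QuantumAdvantage.QuantumAdvantage.Theorems.CubicForrelationSignedCubicForrelationNotPrBPPStubQuarterIdentity
import Summits.QuantumAdvantage.QuantumAdvantage.Theorems.CubicForrelationSignedCubicForrelationNotPrBPPStubPeriodicIdentity
import Summits.QuantumAdvantage.QuantumAdvantage.Theorems.CubicForrelationSignedCubicForrelationNotPrBPPStubCoupledInvariance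
import Summits.QuantumAdvantage.QuantumAdvantage.Theorems.CubicForrelationSignedCubicForrelationNotPrBPPStubKernelNormalForm

/-!
# Skeleton — line `Sketch` on crux `SignedCubicForrelationNotPrBPP` (stmt-QuantumAdvantage-13931)

Lead prover's skeleton (from ideator-3's `Ideator3Sketch.lean`: cards `light-tail-keyless-band` +
`kernel-descent`, triage r1-2 sharpenings applied).

## Shape (honest accounting, cf. `Disproof.lean` §1 `crux_imp_P_ne_PP`)

The crux `X` is a `PromiseBPP'`-NON-membership statement; with the support item
`SignedCubicForrelationMemPromiseBQP` it proves `P ≠ PP` in the tree's classes. Every X-direction line is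
therefore a CONDITIONAL TRANSFER: `SignedCubicForrelationNotPrBPP_of` closes `X` from exactly ONE
load-bearing stub, `stub_terminalHard` (hardness of the TERMINAL sub-family: both cubic tensors
kernel-free, i.e. no affine derivative on either side), by antitonicity of `PromiseBPP'` in the promise.
That stub is separation-strength (the Hadamard-test instances `(b̃, b)` / `(b̃ ⊕ 1, b)` with `b` a
kernel-free cubic bent function lie in the terminal family) and is NOT expected to close; it is the
line's STUCK stub by nature, recorded as such in the lead's Census.

The other five stubs are the KERNEL-DESCENT ENGINE — exact finite-field identities and linear algebra,
all provable now — and they close the second deciding theorem of this file, `descent_step`: a cubic pair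
on `n + 2` bits whose second function has an affine derivative is, after a coupled linear change of
coordinates that preserves `Φ` WITH SIGN, either `1/√2` times a cubic forrelation on `n + 1` bits
(periodic direction) or the plain average of four cubic forrelations on `n` bits (quarter identity).
This is the reduction behind both `X ⇒ TerminalHard` (up to threshold bookkeeping, card kernel-descent)
and the `¬X` programme of crux r7; `stub_dualDistance` is the band lever of card light-tail-keyless-band.

Stubs: `stub_dualDistance` (S0), `stub_quarterIdentity` (K1), `stub_periodicIdentity` (K1'),
`stub_maxQuarterRule` (K2), `stub_coupledInvariance` (K4), `stub_kernelNormalForm` (K3, hardest provable),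
`stub_terminalHard` (T, load-bearing, separation-strength).
-/

set_option linter.dupNamespace false

noncomputable section

open Literature.Computability.QuantumComplexity Literature.Computability.Complexity
open Literature.Computability.QuantumComplexity.BuzetChailloux (bxor zeroVec)
open Literature.Computability.QuantumComplexity.DerivativeWalsh (W)

namespace Summit.QuantumAdvantage.QuantumAdvantage.Cruxes.SignedCubicForrelationNotPrBPP.Sketch

/-! ### S0 — the dual-damage identity (band lever of card light-tail-keyless-band) -/

/-- **S0.** For `b` bent on `m + m` bits with dual `d` (`W_{(-1)^b}(u) = 2^m (-1)^{d(u)}`) and EVERY `a`: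
`Φ(a,b) = 1 − 2·dist(a,d)/2^{2m}`. -/
theorem stub_dualDistance :
    ∀ (m : ℕ) (a b d : (Fin (m + m) → Bool) → Bool),
      (∀ u, W (fun y => signOf (b y)) u = (2 : ℝ) ^ m * signOf (d u)) →
      forrelation a b =
        1 - 2 * ((Finset.univ.filter fun x => a x ≠ d x).card : ℝ) / (2 : ℝ) ^ (m + m) :=
  Summit.QuantumAdvantage.QuantumAdvantage.Theorems.SignedCubicForrelationNotPrBPP.stub_dualDistance

/-! ### K1 — the quarter identity (kernel form, with the constant `c₀` of the affine derivative) -/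

/-- **K1.** For `b(x₀,x₁,x″) = (x₁ ⊕ c₀)·(x₀ ⊕ B₁(x″)) ⊕ B₀(x″)` on `n + 2` bits and EVERY `a`:
`Φ(a,b) = ¼ Σ_{q₀,q₁} Φ(a_q ⊕ q₀q₁ ⊕ q₁c₀, B₀ ⊕ q₀B₁)`, `a_q(u) = a(q₀,q₁,u)`. Exact; no degree or
bentness hypothesis (`W_b(u₀,u₁,u″) = 2 (-1)^{u₀u₁ + u₁c₀} W_{B₀ ⊕ u₀B₁}(u″)`). -/
theorem stub_quarterIdentity :
    ∀ (n : ℕ) (a : (Fin (n + 2) → Bool) → Bool) (B₀ B₁ : (Fin n → Bool) → Bool) (c₀ : Bool),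
      forrelation a
          (fun x => ((x 1 ^^ c₀) && (x 0 ^^ B₁ (Fin.tail (Fin.tail x)))) ^^ B₀ (Fin.tail (Fin.tail x))) =
        (1 / 4 : ℝ) * ∑ q₀ : Bool, ∑ q₁ : Bool,
          forrelation (fun u => (a (Fin.cons q₀ (Fin.cons q₁ u)) ^^ (q₀ && q₁)) ^^ (q₁ && c₀))
            (fun u => B₀ u ^^ (q₀ && B₁ u)) :=
  Summit.QuantumAdvantage.QuantumAdvantage.Theorems.SignedCubicForrelationNotPrBPP.stub_quarterIdentity

/-! ### K1' — the periodic identity (constant derivative) -/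

/-- **K1'.** For `b(x₀,x′) = x₀·c ⊕ B(x′)` on `n + 1` bits and EVERY `a`: `Φ(a,b) = Φ(a(c,·), B)/√2`
(`W_b(u₀,u′) = 2[u₀ = c] W_B(u′)`). -/
theorem stub_periodicIdentity :
    ∀ (n : ℕ) (a : (Fin (n + 1) → Bool) → Bool) (B : (Fin n → Bool) → Bool) (c : Bool),
      forrelation a (fun x => (x 0 && c) ^^ B (Fin.tail x)) =
        (Real.sqrt 2)⁻¹ * forrelation (fun u => a (Fin.cons c u)) B :=
  Summit.QuantumAdvantage.QuantumAdvantage.Theorems.SignedCubicForrelationNotPrBPP.stub_periodicIdentity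

/-! ### K2 — the argmax quarter rule (triage r1-2 sharpening of QuarterSignRule) -/

/-- **K2.** Four reals in `[-1,1]` with average `≥ 3/5`; `p` a quarter whose modulus is within `2ε` of
the maximal modulus, `ε < 1/15`. Then `Φ p > 0` and `|Φ p| ≥ 3/5 − 2ε` (ONE recursive call per level). -/
theorem stub_maxQuarterRule :
    ∀ (Φ : Bool → Bool → ℝ) (ε : ℝ), ε < 1 / 15 → (∀ q₀ q₁, |Φ q₀ q₁| ≤ 1) →
      (3 / 5 : ℝ) ≤ (1 / 4) * ∑ q₀, ∑ q₁, Φ q₀ q₁ → ∀ p₀ p₁ : Bool,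
      (∀ q₀ q₁, |Φ q₀ q₁| ≤ |Φ p₀ p₁| + 2 * ε) →
      0 < Φ p₀ p₁ ∧ 3 / 5 - 2 * ε ≤ |Φ p₀ p₁| := by
  -- LANDED as `Summit.QuantumAdvantage.QuantumAdvantage.Theorems.SignedCubicForrelationNotPrBPP.stub_maxQuarterRule`
  -- (p87645); re-proved inline here (triager r1-2's 12-line script) only so that this workfile does not
  -- depend on that module's hub olean.
  intro Φ ε _hε hb havg p₀ p₁ hmax
  simp only [Fintype.sum_bool] at havg
  have l1 := le_abs_self (Φ true true)
  have l2 := le_abs_self (Φ true false)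
  have l3 := le_abs_self (Φ false true)
  have l4 := le_abs_self (Φ false false)
  have m1 := hmax true true
  have m2 := hmax true false
  have m3 := hmax false true
  have m4 := hmax false false
  have bp := hb p₀ p₁
  constructor
  · by_contra h
    have h' : Φ p₀ p₁ ≤ 0 := not_lt.mp h
    have habs : |Φ p₀ p₁| = -Φ p₀ p₁ := abs_of_nonpos h'
    rcases p₀ with _ | _ <;> rcases p₁ with _ | _ <;> linarith
  · by_contra h
    have h' : |Φ p₀ p₁| < 3 / 5 - 2 * ε := not_le.mp h
    linarith

/-! ### K4 — Φ is invariant under the coupled linear action -/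

/-- **K4.** If two bijections `e, e'` of `𝔽₂ⁿ` are adjoint for the characters
(`(-1)^{e'(u)·e(v)} = (-1)^{u·v}`, i.e. `e' = (eᵀ)⁻¹` for linear `e`), then
`Φ(a ∘ e', b ∘ e) = Φ(a,b)` — the coupled action preserves `Φ` WITH SIGN. -/
theorem stub_coupledInvariance :
    ∀ (n : ℕ) (a b : (Fin n → Bool) → Bool) (e e' : (Fin n → Bool) ≃ (Fin n → Bool)),
      (∀ u v, twist (e' u) (e v) = twist u v) →
      forrelation (fun x => a (e' x)) (fun y => b (e y)) = forrelation a b :=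
  Summit.QuantumAdvantage.QuantumAdvantage.Theorems.SignedCubicForrelationNotPrBPP.stub_coupledInvariance

/-! ### K3 — kernel normal form (hardest provable stub; the lead's) -/

/-- **K3.** Let `b` be cubic on `n + 2` bits with an AFFINE derivative in a direction `h ≠ 0`. Then there
is a coupled pair of bijections `(e, e')` — adjoint for the characters, `e'` degree-preserving — such that
`b ∘ e` is in PERIODIC form `x₀·c ⊕ B(x′)` (`B` cubic) or in KERNEL form
`(x₁ ⊕ c₀)(x₀ ⊕ B₁(x″)) ⊕ B₀(x″)` (`B₀` cubic, `B₁` quadratic). (Coordinates: `h ↦ e₀`; if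
`D_h b = ℓ ⊕ c₀` with `ℓ ≠ 0` then `ℓ(h) = 0` by `h`-periodicity of `D_h b`, and `ℓ ↦ x₁`.) -/
theorem stub_kernelNormalForm :
    ∀ (n : ℕ) (b : (Fin (n + 2) → Bool) → Bool) (h : Fin (n + 2) → Bool),
      h ≠ zeroVec → IsDegLeFun 3 b → IsDegLeFun 1 (fun x => b x ^^ b (bxor x h)) →
      ∃ e e' : (Fin (n + 2) → Bool) ≃ (Fin (n + 2) → Bool),
        (∀ u v, twist (e' u) (e v) = twist u v) ∧
        (∀ (d : ℕ) (f : (Fin (n + 2) → Bool) → Bool), IsDegLeFun d f → IsDegLeFun d (fun x => f (e' x))) ∧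
        ((∃ (c : Bool) (B : (Fin (n + 1) → Bool) → Bool), IsDegLeFun 3 B ∧
            ∀ x, b (e x) = ((x 0 && c) ^^ B (Fin.tail x))) ∨
         (∃ (c₀ : Bool) (B₀ B₁ : (Fin n → Bool) → Bool), IsDegLeFun 3 B₀ ∧ IsDegLeFun 2 B₁ ∧
            ∀ x, b (e x) =
              (((x 1 ^^ c₀) && (x 0 ^^ B₁ (Fin.tail (Fin.tail x)))) ^^ B₀ (Fin.tail (Fin.tail x))))) :=
  Summit.QuantumAdvantage.QuantumAdvantage.Theorems.SignedCubicForrelationNotPrBPP.stub_kernelNormalForm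

/-! ### T — the load-bearing hardness hypothesis (separation-strength; see the file docstring) -/

/-- **T (terminal hardness).** The signed cubic 2-fold Forrelation problem restricted to instances
BOTH of whose circuits compute KERNEL-FREE functions (no direction `h ≠ 0` with an affine derivative)
is not in `PromiseBPP'`. Implies `X` by antitonicity; implies `P ≠ PP` with the Hadamard test
(`Disproof.lean` §1) — NOT a proof target, the line's stuck stub by nature. -/
theorem stub_terminalHard :
    (⟨KForrelationInstance.encode ''
        {I | (I.IsYes ∧ I.k = 2 ∧ Even I.n ∧ ∀ i, IsDegLeFun 3 (I.C i).eval) ∧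
          ∀ i, ¬ ∃ h : Fin I.n → Bool, h ≠ zeroVec ∧
            IsDegLeFun 1 (fun x => (I.C i).eval x ^^ (I.C i).eval (bxor x h))},
      KForrelationInstance.encode ''
        {I | ((I.IsOverB2 ∧ I.value ≤ -(3 / 5 : ℝ)) ∧ I.k = 2 ∧ Even I.n ∧
            ∀ i, IsDegLeFun 3 (I.C i).eval) ∧
          ∀ i, ¬ ∃ h : Fin I.n → Bool, h ≠ zeroVec ∧
            IsDegLeFun 1 (fun x => (I.C i).eval x ^^ (I.C i).eval (bxor x h))}⟩ : PromiseProblem) ∉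
      PromiseBPP' := by
  sorry

/-! ### Compositions (no `sorry` below this line) -/

/-- `PromiseBPP'` is antitone in the promise. -/
theorem promiseBPP'_antitone {Q Q' : PromiseProblem} (hy : Q'.yes ≤ Q.yes) (hn : Q'.no ≤ Q.no)
    (hQ : Q ∈ PromiseBPP') : Q' ∈ PromiseBPP' := by
  obtain ⟨L', hL', p, h1, h2⟩ := hQ
  exact ⟨L', hL', p, fun x hx => h1 x (hy hx), fun x hx => h2 x (hn hx)⟩

/-- **Deciding theorem of the line.** The crux BY NAME: only `stub_terminalHard` (T) is used
(sub-promise transfer by antitonicity); the descent stubs enter through `descent_step` below, which is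
what makes the terminal family the honest residual of `X`. -/
theorem SignedCubicForrelationNotPrBPP_of :
    Summit.QuantumAdvantage.QuantumAdvantage.Theses.CubicForrelation.SignedCubicForrelationNotPrBPP := by
  intro hmem
  apply stub_terminalHard
  refine promiseBPP'_antitone ?_ ?_ hmem
  · rintro _ ⟨I, ⟨hI, -⟩, rfl⟩
    exact ⟨I, hI, rfl⟩
  · rintro _ ⟨I, ⟨hI, -⟩, rfl⟩
    exact ⟨I, hI, rfl⟩

/-- **Descent step (closed modulo the stubs K1, K1', K3, K4, used by name).** A cubic pair on `n + 2`
bits whose second function has an affine derivative in some direction `h ≠ 0` has its SIGNED forrelation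
expressed, exactly, either as `1/√2` times the forrelation of a cubic pair on `n + 1` bits or as the
plain average of the forrelations of four pairs on `n` bits built from cubic data. -/
theorem descent_step
    (n : ℕ) (a b : (Fin (n + 2) → Bool) → Bool) (h : Fin (n + 2) → Bool) (hh : h ≠ zeroVec)
    (ha : IsDegLeFun 3 a) (hb : IsDegLeFun 3 b) (hder : IsDegLeFun 1 (fun x => b x ^^ b (bxor x h))) :
    (∃ (a' : (Fin (n + 2) → Bool) → Bool) (c : Bool) (B : (Fin (n + 1) → Bool) → Bool),
        IsDegLeFun 3 a' ∧ IsDegLeFun 3 B ∧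
        forrelation a b = (Real.sqrt 2)⁻¹ * forrelation (fun u => a' (Fin.cons c u)) B) ∨
    (∃ (a' : (Fin (n + 2) → Bool) → Bool) (c₀ : Bool) (B₀ B₁ : (Fin n → Bool) → Bool),
        IsDegLeFun 3 a' ∧ IsDegLeFun 3 B₀ ∧ IsDegLeFun 2 B₁ ∧
        forrelation a b = (1 / 4 : ℝ) * ∑ q₀ : Bool, ∑ q₁ : Bool,
          forrelation (fun u => (a' (Fin.cons q₀ (Fin.cons q₁ u)) ^^ (q₀ && q₁)) ^^ (q₁ && c₀))
            (fun u => B₀ u ^^ (q₀ && B₁ u))) := by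
  obtain ⟨e, e', hadj, hdeg, hform⟩ := stub_kernelNormalForm n b h hh hb hder
  have hinv := stub_coupledInvariance (n + 2) a b e e' hadj
  rcases hform with ⟨c, B, hB, hbe⟩ | ⟨c₀, B₀, B₁, hB₀, hB₁, hbe⟩
  · refine Or.inl ⟨fun x => a (e' x), c, B, hdeg 3 a ha, hB, ?_⟩
    rw [← hinv, show (fun y => b (e y)) = fun x => (x 0 && c) ^^ B (Fin.tail x) from funext hbe]
    exact stub_periodicIdentity (n + 1) _ B c
  · refine Or.inr ⟨fun x => a (e' x), c₀, B₀, B₁, hdeg 3 a ha, hB₀, hB₁, ?_⟩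
    rw [← hinv, show (fun y => b (e y)) =
      fun x => ((x 1 ^^ c₀) && (x 0 ^^ B₁ (Fin.tail (Fin.tail x)))) ^^ B₀ (Fin.tail (Fin.tail x))
      from funext hbe]
    exact stub_quarterIdentity n _ B₀ B₁ c₀

end Summit.QuantumAdvantage.QuantumAdvantage.Cruxes.SignedCubicForrelationNotPrBPP.Sketch

end
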